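import Literature.AlgebraicGeometry.Resolution.GenericFormMissesFibreComponents
import Literature.AlgebraicGeometry.Resolution.GenericForms
import Literature.AlgebraicGeometry.Resolution.AlterationsMultisectionEtaleNhdChart
import Mathlib.RingTheory.Unramified.Locus
import Mathlib.RingTheory.Unramified.LocalRing
import Mathlib.RingTheory.DiscreteValuationRing.Basic
import HarnessLib

/-!
# A generic member of a linear system on a smooth affine curve has only simple zeros

Topic: `Literature/AlgebraicGeometry/Resolution`. The second genericity statement in de Jong's
proof of his multisection lemma (de Jong 1996, Lemma 4.13, p. 70): "by Bertini the general
hyperplane `H` will intersect `(f⁻¹(y) ∩ sm(X/Y))_red` transversally", i.e. in the set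
`U = {H ∈ 𝐏^∨ | …, H ∩ f⁻¹(y) is a reduced scheme}` the reducedness condition is open and
non-empty. We prove the affine chart-wise form (`exists_ne_zero_forall_locallyGenerates`):

Let `k` be algebraically closed and `D` a finitely generated `k`-algebra of dimension `≤ 1` all
of whose local rings at closed points are discrete valuation rings (an affine chart of the
smooth locus of the fibre, a curve), and `c : ι → D` finitely many functions among which the
constant `1` and, at each closed point, a uniformiser up to a constant (as happens for the
monomials of positive degree in affine coordinates). Then for a non-zero polynomial `h ∈ k[T]`
and every `a ∈ kᶥ` with `h(a) ≠ 0`, the function `g_a = Σ aᵢ cᵢ` generates the maximal ideal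
of the local ring at each of its zeros: `g_a` has only simple zeros.

Proof, by generic avoidance (`Literature.RingTheory.KrullDimension.exists_ne_zero_forall_mem_of_isMaximal`)
applied to the complement `E` of the unramified locus of the total space
`{(x, a) | g_a(x) = 0} → 𝔸ᶥ` (closed: Mathlib `Algebra.isOpen_unramifiedLocus`): at a closed
point `(x, a)` the total space is unramified over `𝔸ᶥ` iff `g_a 𝒪_x = 𝔪_x` (both residue fields
being `k`, unramified means `𝔪_a 𝒪_{(x,a)} = 𝔪_{(x,a)}`, and modulo `(Tᵢ - aᵢ)` this reads
`𝔪_x ⊆ g_a 𝒪_x`: `isUnramifiedAt_pointOver_iff`); in the discrete valuation ring `𝒪_x` an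
element of `𝔪_x` either generates it or lies in `𝔪_x²` (`locallyGenerates_or_mem_sq`), so the
bad parameters over `x` lie in the kernel of the linear map `a ↦ g_a mod 𝔪_x²`, of rank `≥ 2`
(it hits `1` and a uniformiser), i.e. of codimension `≥ 2 = dim D + 1`.

## Relation to `BertiniAffine.lean`

`Literature.AlgebraicGeometry.Resolution.isGeneric_isRegularLocalRing_quotient_linComb`
(`Resolution/BertiniAffine.lean`, Hartshorne II Thm. 8.18 in local-algebra form, landed
concurrently) is the general statement of which the present theorem is the curve case: it treats
a *regular* `k`-algebra `A` of finite type with the tangent-separation hypothesis "`t ↦ Σ tⱼuⱼ`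
surjects onto `A/𝔪²` at every closed point" and concludes that `A_𝔪/(s_t)` is a regular local
ring for generic `t`. A separate formulation is kept here because it is the shape produced and
consumed chart by chart in the proof of de Jong's 4.13 (`GenericFormTransversal`,
`MultisectionHyperplaneGeneric`): the hypotheses are the discrete-valuation-ring property of the
local rings at the closed points and a local uniformiser among the `cⱼ - x` (what the chart
computation `exists_ratio_locallyGenerates` provides), the conclusion is the elementwise
`LocallyGenerates` (no `IsRegularRing D` / cotangent-space bookkeeping downstream), and the
proof goes through the ramified locus of the universal member rather than the smooth locus.
The two are equivalent in the overlap (a one-dimensional `D` with DVR local rings at closed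
points is regular — localisations of a DVR at non-maximal primes are fields; for a DVR `D_𝔪`,
"`D_𝔪/(g)` regular local" is `LocallyGenerates 𝔪 g`; and `1 ∈ c`, a local uniformiser among the
`cⱼ - x` give the surjectivity onto `D/𝔪²`).
TODO(unify): derive `isGeneric_forall_locallyGenerates` from
`isGeneric_isRegularLocalRing_quotient_linComb` through these three bridge lemmas.

## References

* A. J. de Jong, *Smoothness, semi-stability and alterations*, Publ. Math. IHÉS 83 (1996),
  Lemma 4.13 (proof), p. 70. [DeJong1996]
* R. Hartshorne, *Algebraic Geometry*, GTM 52 (1977), II Thm. 8.18 (Bertini). [Hartshorne1977]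
-/

noncomputable section

open MvPolynomial AlgebraicGeometry PrimeSpectrum Topology IsLocalRing

namespace Literature.AlgebraicGeometry.Resolution

universe u v

/-! ### Local generation of a maximal ideal by one element -/

section LocallyGenerates

variable {D : Type*} [CommSemiring D]

/-- `g` **generates the maximal ideal `𝔪` locally at `𝔪`**: every element of `𝔪` becomes a
multiple of `g` after multiplication by an element outside `𝔪`, i.e. `𝔪 D_𝔪 ⊆ g D_𝔪`
(elementwise form, avoiding the localisation). [folklore] -/
def LocallyGenerates (𝔪 : Ideal D) (g : D) : Prop :=
  ∀ d ∈ 𝔪, ∃ s ∉ 𝔪, s * d ∈ Ideal.span {g}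

/-- Membership in an extended ideal of the localisation at a prime, elementwise: `d/1 ∈ I D_𝔪`
iff `s d ∈ I` for some `s ∉ 𝔪`. [folklore] -/
theorem algebraMap_mem_map_localization_iff (𝔪 : Ideal D) [𝔪.IsPrime] (L : Type*)
    [CommSemiring L] [Algebra D L] [IsLocalization.AtPrime L 𝔪] (I : Ideal D) (d : D) :
    algebraMap D L d ∈ I.map (algebraMap D L) ↔ ∃ s ∉ 𝔪, s * d ∈ I := by
  rw [IsLocalization.mem_map_algebraMap_iff 𝔪.primeCompl L]
  constructor
  · rintro ⟨⟨⟨i, hi⟩, ⟨s, hs⟩⟩, h⟩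
    dsimp only at h
    rw [← map_mul, IsLocalization.eq_iff_exists 𝔪.primeCompl L] at h
    obtain ⟨⟨t, ht⟩, h⟩ := h
    refine ⟨t * s, fun hmem => ?_, ?_⟩
    · exact (Ideal.IsPrime.mem_or_mem inferInstance hmem).elim ht hs
    · have : t * s * d = t * i := by rw [← h]; ring
      rw [this]
      exact I.mul_mem_left _ hi
  · rintro ⟨s, hs, h⟩
    refine ⟨⟨⟨s * d, h⟩, ⟨s, hs⟩⟩, ?_⟩
    simp [map_mul, mul_comm]

end LocallyGenerates

section LocallyGeneratesRing

variable {D : Type*} [CommRing D]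

/-- If `g ∈ 𝔪` generates `𝔪` locally, the maximal ideal of `D_𝔪` is generated by `g`.
[folklore] -/
theorem LocallyGenerates.maximalIdeal_eq {𝔪 : Ideal D} [𝔪.IsPrime] {g : D}
    (h : LocallyGenerates 𝔪 g) (hg : g ∈ 𝔪) :
    maximalIdeal (Localization.AtPrime 𝔪) =
      Ideal.span {algebraMap D (Localization.AtPrime 𝔪) g} := by
  apply le_antisymm
  · rw [← Localization.AtPrime.map_eq_maximalIdeal, Ideal.map_le_iff_le_comap]
    intro d hd
    rw [Ideal.mem_comap, ← Set.image_singleton, ← Ideal.map_span,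
      algebraMap_mem_map_localization_iff 𝔪]
    exact h d hd
  · rw [Ideal.span_le, Set.singleton_subset_iff, SetLike.mem_coe,
      IsLocalization.AtPrime.to_map_mem_maximal_iff (Localization.AtPrime 𝔪) 𝔪]
    exact hg

/-- Conversely, if the maximal ideal of `D_𝔪` lies in `(g)`, then `g` generates `𝔪` locally.
[folklore] -/
theorem locallyGenerates_of_maximalIdeal_le {𝔪 : Ideal D} [𝔪.IsPrime] {g : D}
    (h : maximalIdeal (Localization.AtPrime 𝔪) ≤
      Ideal.span {algebraMap D (Localization.AtPrime 𝔪) g}) :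
    LocallyGenerates 𝔪 g := by
  intro d hd
  have h1 : algebraMap D (Localization.AtPrime 𝔪) d ∈
      (Ideal.span {g}).map (algebraMap D (Localization.AtPrime 𝔪)) := by
    rw [Ideal.map_span, Set.image_singleton]
    exact h ((IsLocalization.AtPrime.to_map_mem_maximal_iff (Localization.AtPrime 𝔪) 𝔪 d).mpr hd)
  exact (algebraMap_mem_map_localization_iff 𝔪 _ _ d).mp h1

/-- **In a discrete valuation ring an element of the maximal ideal either generates it or lies
in its square.** For a prime `𝔪` of `D` with `D_𝔪` a discrete valuation ring and `g ∈ 𝔪`: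
either `g` generates `𝔪` locally, or `g/1 ∈ (𝔪 D_𝔪)²`. [folklore] -/
theorem locallyGenerates_or_mem_sq (𝔪 : Ideal D) [𝔪.IsPrime]
    [IsDomain (Localization.AtPrime 𝔪)] [IsDiscreteValuationRing (Localization.AtPrime 𝔪)] {g : D} (hg : g ∈ 𝔪) :
    LocallyGenerates 𝔪 g ∨
      algebraMap D (Localization.AtPrime 𝔪) g ∈ (maximalIdeal (Localization.AtPrime 𝔪)) ^ 2 := by
  set O := Localization.AtPrime 𝔪
  set x := algebraMap D O g with hx
  by_cases hx0 : x = 0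
  · exact Or.inr (hx0 ▸ zero_mem _)
  obtain ⟨ϖ, hϖ⟩ := IsDiscreteValuationRing.exists_irreducible O
  obtain ⟨n, u, hu⟩ := IsDiscreteValuationRing.eq_unit_mul_pow_irreducible hx0 hϖ
  have hxm : x ∈ maximalIdeal O :=
    (IsLocalization.AtPrime.to_map_mem_maximal_iff O 𝔪 g).mpr hg
  have hn : n ≠ 0 := by
    rintro rfl
    rw [pow_zero, mul_one] at hu
    exact (IsLocalRing.mem_maximalIdeal _).mp hxm (hu ▸ u.isUnit)
  rcases Nat.lt_or_ge n 2 with hlt | hge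
  · -- `n = 1`: `x` is a uniformiser
    have hn1 : n = 1 := by omega
    subst hn1
    rw [pow_one] at hu
    left
    refine locallyGenerates_of_maximalIdeal_le (le_of_eq ?_)
    rw [hϖ.maximalIdeal_eq, ← hx, hu]
    exact (Ideal.span_singleton_mul_left_unit u.isUnit ϖ).symm
  · right
    rw [hu]
    refine Ideal.mul_mem_left _ _ (Ideal.pow_le_pow_right hge ?_)
    rw [hϖ.maximalIdeal_eq]
    exact Ideal.pow_mem_pow (Ideal.subset_span (Set.mem_singleton ϖ)) n

/-- A local generator of the maximal ideal of a discrete valuation ring `D_𝔪` does not lie in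
the square of the maximal ideal. [folklore] -/
theorem LocallyGenerates.not_mem_sq {𝔪 : Ideal D} [𝔪.IsPrime]
    [IsDomain (Localization.AtPrime 𝔪)] [IsDiscreteValuationRing (Localization.AtPrime 𝔪)]
    {g : D} (h : LocallyGenerates 𝔪 g)
    (hg : g ∈ 𝔪) :
    algebraMap D (Localization.AtPrime 𝔪) g ∉ (maximalIdeal (Localization.AtPrime 𝔪)) ^ 2 := by
  set O := Localization.AtPrime 𝔪
  set x := algebraMap D O g with hx
  intro hmem
  have hmax := h.maximalIdeal_eq hg
  rw [hmax, pow_two, Ideal.span_singleton_mul_span_singleton, Ideal.mem_span_singleton] at hmem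
  obtain ⟨t, ht⟩ := hmem
  have h1 : x * (1 - x * t) = 0 := by rw [mul_sub, mul_one, ← mul_assoc, ← ht, sub_self]
  have hunit : IsUnit (1 - x * t) := by
    apply IsLocalRing.isUnit_one_sub_self_of_mem_nonunits
    rw [← IsLocalRing.mem_maximalIdeal]
    exact Ideal.mul_mem_right _ _ ((IsLocalization.AtPrime.to_map_mem_maximal_iff O 𝔪 g).mpr hg)
  have hx0 : x = 0 := by
    rcases mul_eq_zero.mp h1 with h0 | h0
    · exact h0
    · exact absurd (h0 ▸ hunit) not_isUnit_zero
  apply IsDiscreteValuationRing.not_a_field' (R := O)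
  rw [hmax, ← hx, hx0]
  simp

end LocallyGeneratesRing

/-! ### The total space of the linear system over `𝔸ᶥ` and its unramified locus -/

section Universal

variable (k : Type u) [Field k] {D : Type u} [CommRing D] [Algebra k D] {ι : Type v} [Fintype ι]
  (c : ι → D)

/-- The total space `{(x, a) | g_a(x) = 0}` as an algebra over the parameter ring `k[T]`.
[folklore] -/
@[reducible]
def univAlgebra : Algebra (MvPolynomial ι k) (UnivQuot c) :=
  (univHom k (Algebra.ofId k D) c).toAlgebra

attribute [local instance] univAlgebra

/-- The structure map of `univAlgebra` is `univHom`. [folklore] -/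
theorem algebraMap_univQuot (q : MvPolynomial ι k) :
    algebraMap (MvPolynomial ι k) (UnivQuot c) q =
      Ideal.Quotient.mk (Ideal.span {univComb c}) (MvPolynomial.map (algebraMap k D) q) := rfl

/-- `k → k[T] → A[T]/(𝔤)` is the `k`-structure of the total space. [folklore] -/
theorem algebraMap_comp_C :
    (algebraMap (MvPolynomial ι k) (UnivQuot c)).comp (C : k →+* MvPolynomial ι k) =
      algebraMap k (UnivQuot c) := by
  apply RingHom.ext
  intro t
  change Ideal.Quotient.mk _ (MvPolynomial.map (algebraMap k D) (C t)) = _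
  rw [map_C]
  rfl

variable [Algebra.FiniteType k D]

include k in
/-- The total space is of finite type over the parameter ring. [folklore] -/
theorem finiteType_univQuot : Algebra.FiniteType (MvPolynomial ι k) (UnivQuot c) := by
  haveI : Algebra.FiniteType k (MvPolynomial ι D) :=
    (inferInstance : Algebra.FiniteType k D).trans inferInstance
  haveI : Algebra.FiniteType k (UnivQuot c) :=
    Algebra.FiniteType.of_surjective (Ideal.Quotient.mkₐ k _) Ideal.Quotient.mk_surjective
  have h : (algebraMap (MvPolynomial ι k) (UnivQuot c)).FiniteType := by
    refine RingHom.FiniteType.of_comp_finiteType (f := (C : k →+* MvPolynomial ι k)) ?_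
    rw [algebraMap_comp_C]
    exact RingHom.finiteType_algebraMap.mpr inferInstance
  exact RingHom.finiteType_algebraMap.mp h

end Universal

/-! ### Unramifiedness at a closed point of the total space -/

section Bridge

variable (k : Type u) [Field k] [IsAlgClosed k] {D : Type u} [CommRing D] [Algebra k D]
  [Algebra.FiniteType k D] {ι : Type v} [Fintype ι] (c : ι → D)

attribute [local instance] univAlgebra

omit [IsAlgClosed k] [Fintype ι] in
/-- The ideal of the point `a ∈ kᶥ` is the kernel of evaluation at `a`, generated by the
`Tᵢ - aᵢ`. [folklore] -/
theorem ker_eval_eq_span (a : ι → k) :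
    RingHom.ker (eval a : MvPolynomial ι k →+* k) =
      Ideal.span (Set.range fun i => (X i - C (a i) : MvPolynomial ι k)) :=
  le_antisymm (ker_eval_le_of_forall_X_sub_C_mem a fun i => Ideal.subset_span ⟨i, rfl⟩)
    (Ideal.span_le.mpr (Set.range_subset_iff.mpr fun i => by simp [RingHom.mem_ker]))

omit [IsAlgClosed k] [Algebra.FiniteType k D] in
/-- The point `(x, a)` of the total space lies over the point `a` of `𝔸ᶥ`. [folklore] -/
theorem under_pointOver (a : ι → k) (𝔪 : Ideal D) [𝔪.IsMaximal] (hg : ∑ i, a i • c i ∈ 𝔪) :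
    (pointOver k c a 𝔪 hg).asIdeal.under (MvPolynomial ι k) = RingHom.ker (eval a) := by
  ext q
  rw [Ideal.under_def, Ideal.mem_comap, algebraMap_univQuot, ← Ideal.mem_comap,
    comap_mk_pointOver, Ideal.mem_comap, evalParams_map_algebraMap, RingHom.mem_ker]
  constructor
  · intro h
    by_contra hne
    exact (Ideal.IsMaximal.ne_top inferInstance)
      (Ideal.eq_top_of_isUnit_mem _ h ((IsUnit.mk0 _ hne).map _))
  · intro h
    rw [h, map_zero]
    exact zero_mem _

omit [IsAlgClosed k] [Algebra.FiniteType k D] in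
/-- The point `(x, a)` over a closed point `x` is a closed point of the total space. [folklore] -/
theorem isMaximal_pointOver (a : ι → k) (𝔪 : Ideal D) [𝔪.IsMaximal] (hg : ∑ i, a i • c i ∈ 𝔪) :
    (pointOver k c a 𝔪 hg).asIdeal.IsMaximal := by
  haveI : (𝔪.comap (evalParams k a)).IsMaximal :=
    Ideal.comap_isMaximal_of_surjective _ (evalParams_surjective k a)
  change ((𝔪.comap (evalParams k a)).map _).IsMaximal
  refine (Ideal.map_eq_top_or_isMaximal_of_surjective _ Ideal.Quotient.mk_surjective
    this).resolve_left fun htop => this.ne_top ?_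
  have h := comap_mk_pointOver k c a 𝔪 hg
  change ((𝔪.comap (evalParams k a)).map _).comap _ = _ at h
  rw [htop, Ideal.comap_top] at h
  exact h.symm

/-- The reduction map `A[T]/(𝔤) → D/(g_a)`, `T ↦ a`. [folklore] -/
def reduceAt (a : ι → k) : UnivQuot c →+* D ⧸ Ideal.span {∑ i, a i • c i} :=
  Ideal.Quotient.lift (Ideal.span {univComb c})
    ((Ideal.Quotient.mk (Ideal.span {∑ i, a i • c i})).comp (evalParams k a))
    (fun p hp => by
      rw [Ideal.mem_span_singleton] at hp
      obtain ⟨q, rfl⟩ := hp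
      rw [RingHom.comp_apply, map_mul, evalParams_univComb, Ideal.Quotient.eq_zero_iff_mem]
      exact Ideal.mul_mem_right _ _ (Ideal.subset_span (Set.mem_singleton _)))

omit [IsAlgClosed k] [Algebra.FiniteType k D] in
/-- `reduceAt` on representatives. [folklore] -/
theorem reduceAt_mk (a : ι → k) (p : MvPolynomial ι D) :
    reduceAt k c a (Ideal.Quotient.mk _ p) = Ideal.Quotient.mk _ (evalParams k a p) := rfl

omit [IsAlgClosed k] [Algebra.FiniteType k D] in
/-- `reduceAt` kills the `Tᵢ - aᵢ`. [folklore] -/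
theorem reduceAt_X_sub_C (a : ι → k) (i : ι) :
    reduceAt k c a (Ideal.Quotient.mk _ (X i - C (algebraMap k D (a i)))) = 0 := by
  rw [reduceAt_mk]
  simp [evalParams]

/-- **Unramifiedness of the total space at a closed point `(x, a)` means that `g_a` generates
`𝔪_x` locally.** Both residue fields are `k`, so (Mathlib `Algebra.isUnramifiedAt_iff_map_eq`)
the total space `{g = 0} → 𝔸ᶥ` is unramified at `(x, a)` iff `𝔪_a 𝒪_{(x,a)} = 𝔪_{(x,a)}`;
modulo the `Tᵢ - aᵢ` this says `𝔪_x ⊆ g_a D` locally at `x`. [folklore] -/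
theorem isUnramifiedAt_pointOver_iff (a : ι → k) (𝔪 : Ideal D) [𝔪.IsMaximal]
    (hg : ∑ i, a i • c i ∈ 𝔪) :
    Algebra.IsUnramifiedAt (MvPolynomial ι k) (pointOver k c a 𝔪 hg).asIdeal ↔
      LocallyGenerates 𝔪 (∑ i, a i • c i) := by
  classical
  set g : D := ∑ i, a i • c i with hgdef
  set 𝔔 : Ideal (UnivQuot c) := (pointOver k c a 𝔪 hg).asIdeal with h𝔔
  set 𝔭 : Ideal (MvPolynomial ι k) := RingHom.ker (eval a) with h𝔭
  haveI h𝔭max : 𝔭.IsMaximal := RingHom.ker_isMaximal_of_surjective _ fun t => ⟨C t, eval_C t⟩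
  haveI h𝔔max : 𝔔.IsMaximal := isMaximal_pointOver k c a 𝔪 hg
  haveI : 𝔔.LiesOver 𝔭 := ⟨(under_pointOver k c a 𝔪 hg).symm⟩
  letI := Localization.AtPrime.algebraOfLiesOver 𝔭 𝔔
  haveI : Algebra.FiniteType (MvPolynomial ι k) (UnivQuot c) := finiteType_univQuot k c
  haveI : Algebra.EssFiniteType (MvPolynomial ι k) (UnivQuot c) :=
    Algebra.EssFiniteType.of_finiteType _ _
  -- separability of the residue fields (both are `k`)
  have hsep : Algebra.IsSeparable 𝔭.ResidueField 𝔔.ResidueField := by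
    refine isSeparable_residueField_of_isAlgClosed (C : k →+* MvPolynomial ι k) ?_ 𝔭 𝔔
    rw [algebraMap_comp_C]
    haveI : Algebra.FiniteType k (MvPolynomial ι D) :=
      (inferInstance : Algebra.FiniteType k D).trans inferInstance
    haveI : Algebra.FiniteType k (UnivQuot c) :=
      Algebra.FiniteType.of_surjective (Ideal.Quotient.mkₐ k _) Ideal.Quotient.mk_surjective
    exact RingHom.finiteType_algebraMap.mpr inferInstance
  rw [Algebra.isUnramifiedAt_iff_map_eq (MvPolynomial ι k) 𝔭 𝔔, and_iff_right hsep]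
  -- `𝔭 S_𝔔 = 𝔔 S_𝔔` iff every `q ∈ 𝔔` has `s q ∈ 𝔭 S` for some `s ∉ 𝔔`
  set 𝔭S : Ideal (UnivQuot c) := 𝔭.map (algebraMap (MvPolynomial ι k) (UnivQuot c)) with h𝔭S
  have h𝔭S𝔔 : 𝔭S ≤ 𝔔 := by
    rw [h𝔭S, Ideal.map_le_iff_le_comap, ← Ideal.under_def,
      ← Ideal.LiesOver.over (p := 𝔭) (P := 𝔔)]
  rw [IsScalarTower.algebraMap_eq (MvPolynomial ι k) (UnivQuot c) (Localization.AtPrime 𝔔),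
    ← Ideal.map_map, ← Localization.AtPrime.map_eq_maximalIdeal]
  change 𝔭S.map _ = _ ↔ _
  have key : 𝔭S.map (algebraMap (UnivQuot c) (Localization.AtPrime 𝔔)) =
      𝔔.map (algebraMap (UnivQuot c) (Localization.AtPrime 𝔔)) ↔
        ∀ q ∈ 𝔔, ∃ s ∉ 𝔔, s * q ∈ 𝔭S := by
    constructor
    · intro h q hq
      have h1 : algebraMap (UnivQuot c) (Localization.AtPrime 𝔔) q ∈
          𝔭S.map (algebraMap (UnivQuot c) (Localization.AtPrime 𝔔)) :=
        h ▸ Ideal.mem_map_of_mem _ hq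
      exact (algebraMap_mem_map_localization_iff 𝔔 _ _ q).mp h1
    · intro h
      apply le_antisymm (Ideal.map_mono h𝔭S𝔔)
      rw [Ideal.map_le_iff_le_comap]
      intro q hq
      rw [Ideal.mem_comap, algebraMap_mem_map_localization_iff 𝔔]
      exact h q hq
  rw [key]
  -- description of `𝔭 S` and of membership in `𝔔`
  let mkg := Ideal.Quotient.mk (Ideal.span {univComb c})
  have hfun : (fun i => algebraMap (MvPolynomial ι k) (UnivQuot c) (X i - C (a i))) =
      fun i => mkg (X i - C (algebraMap k D (a i))) := by
    funext i
    rw [algebraMap_univQuot, map_sub, map_X, map_C]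
  have h𝔭Sspan : 𝔭S = Ideal.span (Set.range fun i => mkg (X i - C (algebraMap k D (a i)))) := by
    rw [h𝔭S, h𝔭, ker_eval_eq_span, Ideal.map_span, ← Set.range_comp]
    change Ideal.span (Set.range fun i => algebraMap _ _ (X i - C (a i))) = _
    rw [hfun]
  have hmem𝔔 : ∀ p : MvPolynomial ι D, mkg p ∈ 𝔔 ↔ evalParams k a p ∈ 𝔪 := fun p => by
    rw [← Ideal.mem_comap, ← Ideal.mem_comap, h𝔔, comap_mk_pointOver]
  have hρ𝔭S : ∀ s ∈ 𝔭S, reduceAt k c a s = 0 := by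
    rw [h𝔭Sspan]
    refine fun s hs => Submodule.span_induction (p := fun s _ => reduceAt k c a s = 0)
      ?_ ?_ ?_ ?_ hs
    · rintro _ ⟨i, rfl⟩; exact reduceAt_X_sub_C k c a i
    · exact map_zero _
    · intro x y _ _ hx hy; rw [map_add, hx, hy, add_zero]
    · intro r x _ hx; rw [smul_eq_mul, map_mul, hx, mul_zero]
  constructor
  · -- unramified ⇒ `g_a` generates `𝔪` locally
    intro h d hd
    have hq : mkg (C d) ∈ 𝔔 := (hmem𝔔 _).mpr (by simpa [evalParams] using hd)
    obtain ⟨s, hs, hsq⟩ := h _ hq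
    obtain ⟨p, rfl⟩ := Ideal.Quotient.mk_surjective s
    refine ⟨evalParams k a p, fun hp => hs ((hmem𝔔 p).mpr hp), ?_⟩
    have h1 := hρ𝔭S _ hsq
    rw [← map_mul, reduceAt_mk, map_mul, Ideal.Quotient.eq_zero_iff_mem] at h1
    simpa [evalParams] using h1
  · -- `g_a` generates `𝔪` locally ⇒ unramified
    intro h q hq
    obtain ⟨p, rfl⟩ := Ideal.Quotient.mk_surjective q
    have hp : evalParams k a p ∈ 𝔪 := (hmem𝔔 p).mp hq
    obtain ⟨s₀, hs₀, hmul⟩ := h _ hp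
    obtain ⟨e, he⟩ := Ideal.mem_span_singleton'.mp hmul
    refine ⟨mkg (C s₀), fun hs => hs₀ (by simpa [evalParams] using (hmem𝔔 _).mp hs), ?_⟩
    -- `C s₀ * p - C e * 𝔤 ∈ (Tᵢ - aᵢ)`
    have hker : C s₀ * p - C e * univComb c ∈
        Ideal.span (Set.range fun i => (X i - C (algebraMap k D (a i)) : MvPolynomial ι D)) := by
      refine ker_eval_le_of_forall_X_sub_C_mem _
        (fun i => Ideal.subset_span (Set.mem_range_self i)) ?_
      rw [RingHom.mem_ker, map_sub, map_mul, map_mul]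
      change evalParams k a (C s₀) * evalParams k a p - evalParams k a (C e) * evalParams k a (univComb c) = 0
      rw [evalParams_univComb]
      simp only [evalParams, eval_C]
      rw [← hgdef, he, sub_self]
    have h2 : mkg (C s₀ * p - C e * univComb c) ∈ 𝔭S := by
      have hset : (Set.range fun i => mkg (X i - C (algebraMap k D (a i)))) =
          mkg '' Set.range (fun i => (X i - C (algebraMap k D (a i)) : MvPolynomial ι D)) := by
        rw [← Set.range_comp]; rfl
      rw [h𝔭Sspan, hset, ← Ideal.map_span]
      exact Ideal.mem_map_of_mem _ hker
    have h3 : mkg (C e * univComb c) = 0 :=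
      Ideal.Quotient.eq_zero_iff_mem.mpr (Ideal.mul_mem_left _ _ (Ideal.subset_span (Set.mem_singleton _)))
    have : mkg (C s₀) * mkg p = mkg (C s₀ * p - C e * univComb c) + mkg (C e * univComb c) := by
      rw [← map_mul, ← map_add, sub_add_cancel]
    rw [this, h3, add_zero]
    exact h2

end Bridge

/-! ### The rank of `a ↦ g_a mod 𝔪_x²` -/

section Rank

variable (k : Type u) [Field k] {D : Type u} [CommRing D] [Algebra k D] {ι : Type v} [Fintype ι]
  (c : ι → D)

/-- The `k`-linear map `a ↦ g_a mod (𝔪 D_𝔪)²` into the truncated local ring at `𝔪`.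
[folklore] -/
def truncAt (𝔪 : Ideal D) [𝔪.IsPrime] :
    (ι → k) →ₗ[k] (Localization.AtPrime 𝔪 ⧸ (maximalIdeal (Localization.AtPrime 𝔪)) ^ 2) :=
  (Ideal.Quotient.mkₐ k ((maximalIdeal (Localization.AtPrime 𝔪)) ^ 2)).toLinearMap ∘ₗ
    (Algebra.linearMap D (Localization.AtPrime 𝔪)).restrictScalars k ∘ₗ
      Fintype.linearCombination k c

/-- Unfolding `truncAt`. [folklore] -/
theorem truncAt_apply (𝔪 : Ideal D) [𝔪.IsPrime] (a : ι → k) :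
    truncAt k c 𝔪 a =
      Ideal.Quotient.mk _ (algebraMap D (Localization.AtPrime 𝔪) (∑ i, a i • c i)) := by
  simp only [truncAt, LinearMap.coe_comp, Function.comp_apply, Fintype.linearCombination_apply,
    LinearMap.coe_restrictScalars, Algebra.linearMap_apply, AlgHom.toLinearMap_apply,
    Ideal.Quotient.mkₐ_eq_mk]

/-- If `g_a ∈ (𝔪 D_𝔪)²` then `a` lies in the kernel of `truncAt`. [folklore] -/
theorem truncAt_eq_zero_of_mem_sq (𝔪 : Ideal D) [𝔪.IsPrime] {a : ι → k}
    (h : algebraMap D (Localization.AtPrime 𝔪) (∑ i, a i • c i) ∈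
      (maximalIdeal (Localization.AtPrime 𝔪)) ^ 2) :
    truncAt k c 𝔪 a = 0 := by
  rw [truncAt_apply, Ideal.Quotient.eq_zero_iff_mem]
  exact h

/-- **`truncAt` has rank `≥ 2`** as soon as the `cᵢ` contain `1` and, up to a constant, a local
generator of `𝔪` (for `D_𝔪` a discrete valuation ring): the classes of `1` and of a
uniformiser in `D_𝔪/(𝔪 D_𝔪)²` are `k`-linearly independent. [folklore] -/
theorem two_le_finrank_range_truncAt (𝔪 : Ideal D) [𝔪.IsMaximal]
    [IsDomain (Localization.AtPrime 𝔪)] [IsDiscreteValuationRing (Localization.AtPrime 𝔪)]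
    {i₀ j : ι} (h1 : c i₀ = 1) {x : k} (hj : c j - algebraMap k D x ∈ 𝔪)
    (hgen : LocallyGenerates 𝔪 (c j - algebraMap k D x)) :
    2 ≤ Module.finrank k (LinearMap.range (truncAt k c 𝔪)) := by
  classical
  set O := Localization.AtPrime 𝔪 with hO
  set ϖ : O := algebraMap D O (c j - algebraMap k D x) with hϖ
  have hϖsq : ϖ ∉ (maximalIdeal O) ^ 2 := hgen.not_mem_sq hj
  have hϖm : ϖ ∈ maximalIdeal O := (IsLocalization.AtPrime.to_map_mem_maximal_iff O 𝔪 _).mpr hj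
  -- the two vectors
  let e₁ : ι → k := Pi.single i₀ 1
  let e₂ : ι → k := Pi.single j 1 - x • Pi.single i₀ 1
  have hsum₁ : ∑ i, e₁ i • c i = 1 := by
    simp only [e₁]
    rw [Finset.sum_eq_single i₀]
    · simp [h1]
    · intro i _ hi; simp [Pi.single_eq_of_ne hi]
    · intro h; exact absurd (Finset.mem_univ _) h
  have hsum₂ : ∑ i, e₂ i • c i = c j - algebraMap k D x := by
    have : ∀ i, e₂ i • c i = (Pi.single j (1 : k) : ι → k) i • c i - x • ((Pi.single i₀ (1 : k) : ι → k) i • c i) := by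
      intro i
      simp only [e₂, Pi.sub_apply, Pi.smul_apply, smul_eq_mul, sub_smul, mul_smul]
    simp only [this, Finset.sum_sub_distrib, ← Finset.smul_sum]
    rw [show ∑ i, (Pi.single i₀ (1 : k) : ι → k) i • c i = 1 from hsum₁, Finset.sum_eq_single j]
    · simp [Algebra.smul_def]
    · intro i _ hi; simp [Pi.single_eq_of_ne hi]
    · intro h; exact absurd (Finset.mem_univ _) h
  have hv₁ : truncAt k c 𝔪 e₁ = Ideal.Quotient.mk _ 1 := by
    rw [truncAt_apply, hsum₁, map_one]
  have hv₂ : truncAt k c 𝔪 e₂ = Ideal.Quotient.mk _ ϖ := by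
    rw [truncAt_apply, hsum₂]
  -- linear independence of the classes of `1` and `ϖ`
  have hsmul : ∀ (t : k) (y : O),
      Ideal.Quotient.mk ((maximalIdeal O) ^ 2) (t • y) = t • Ideal.Quotient.mk _ y :=
    fun t y => map_smul (Ideal.Quotient.mkₐ k ((maximalIdeal O) ^ 2)) t y
  have hli : LinearIndependent k ![truncAt k c 𝔪 e₁, truncAt k c 𝔪 e₂] := by
    rw [LinearIndependent.pair_iff]
    intro α β hαβ
    rw [hv₁, hv₂] at hαβ
    have key : algebraMap k O α + algebraMap k O β * ϖ ∈ (maximalIdeal O) ^ 2 := by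
      have : algebraMap k O α + algebraMap k O β * ϖ = α • (1 : O) + β • ϖ := by
        rw [Algebra.smul_def, Algebra.smul_def, mul_one]
      rw [← Ideal.Quotient.eq_zero_iff_mem, this, map_add, hsmul, hsmul]
      exact hαβ
    have hα : α = 0 := by
      by_contra hα
      have hmem : algebraMap k O α ∈ maximalIdeal O := by
        have h2 : algebraMap k O α + algebraMap k O β * ϖ ∈ maximalIdeal O :=
          Ideal.pow_le_self two_ne_zero key
        have h3 : algebraMap k O β * ϖ ∈ maximalIdeal O := Ideal.mul_mem_left _ _ hϖm
        simpa using sub_mem h2 h3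
      exact (IsLocalRing.mem_maximalIdeal _).mp hmem ((IsUnit.mk0 α hα).map _)
    subst hα
    have hβ : β = 0 := by
      by_contra hβ
      rw [map_zero, zero_add] at key
      have hu : IsUnit (algebraMap k O β) := (IsUnit.mk0 β hβ).map _
      exact hϖsq ((Ideal.unit_mul_mem_iff_mem _ hu).mp key)
    exact ⟨rfl, hβ⟩
  have hspan : Submodule.span k (Set.range ![truncAt k c 𝔪 e₁, truncAt k c 𝔪 e₂]) ≤
      LinearMap.range (truncAt k c 𝔪) := by
    rw [Submodule.span_le]
    rintro _ ⟨i, rfl⟩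
    fin_cases i <;> exact LinearMap.mem_range_self _ _
  calc 2 = Module.finrank k
        (Submodule.span k (Set.range ![truncAt k c 𝔪 e₁, truncAt k c 𝔪 e₂])) := by
          rw [finrank_span_eq_card hli]; simp
    _ ≤ _ := Submodule.finrank_mono hspan

end Rank

/-! ### The theorem -/

section Main

variable (k : Type u) [Field k] [IsAlgClosed k] {D : Type u} [CommRing D] [Algebra k D]
  [Algebra.FiniteType k D] {ι : Type v} [Fintype ι] [DecidableEq ι] (c : ι → D)

attribute [local instance] univAlgebra

include k in
/-- **A generic member of a linear system on a smooth affine curve has only simple zeros.**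
Let `k` be algebraically closed, `D` a finitely generated `k`-algebra of dimension `≤ 1` whose
local rings at closed points are discrete valuation rings, and `c : ι → D` functions containing
`1` and, at each closed point `𝔪`, some `cⱼ - x` (`x ∈ k`) generating `𝔪` locally. Then there
is a non-zero `h ∈ k[T]` such that for all `a ∈ kᶥ` with `h(a) ≠ 0` and every closed point
`𝔪 ∋ g_a = Σ aᵢ cᵢ`, `g_a` generates `𝔪 D_𝔪`: the zero scheme of `g_a` is reduced (de Jong:
"by Bertini the general hyperplane `H` will intersect `(f⁻¹(y) ∩ sm(X/Y))_red` transversally").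
This is the curve case, in the `LocallyGenerates` shape used by the 4.13 charts, of the affine
Bertini theorem `isGeneric_isRegularLocalRing_quotient_linComb` of `BertiniAffine.lean`
(Hartshorne II Thm. 8.18; see "Relation to `BertiniAffine.lean`" in the file header); the
`IsGeneric` form is `isGeneric_forall_locallyGenerates_sum_smul`.
[cite: DeJong1996, Lemma 4.13 (proof), p. 70] -/
theorem exists_ne_zero_forall_locallyGenerates (hD : ringKrullDim D ≤ 1)
    (hdvr : ∀ (𝔪 : Ideal D) [𝔪.IsMaximal],
      ∃ _ : IsDomain (Localization.AtPrime 𝔪), IsDiscreteValuationRing (Localization.AtPrime 𝔪))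
    (h1 : ∃ i₀, c i₀ = 1)
    (hunif : ∀ (𝔪 : Ideal D) [𝔪.IsMaximal], ∃ (j : ι) (x : k),
      c j - algebraMap k D x ∈ 𝔪 ∧ LocallyGenerates 𝔪 (c j - algebraMap k D x)) :
    ∃ h : MvPolynomial ι k, h ≠ 0 ∧ ∀ a : ι → k, eval a h ≠ 0 →
      ∀ (𝔪 : Ideal D) [𝔪.IsMaximal], ∑ i, a i • c i ∈ 𝔪 →
        LocallyGenerates 𝔪 (∑ i, a i • c i) := by
  classical
  obtain ⟨i₀, hi₀⟩ := h1
  haveI : IsNoetherianRing D := Algebra.FiniteType.isNoetherianRing k D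
  haveI : Algebra.FiniteType (MvPolynomial ι k) (UnivQuot c) := finiteType_univQuot k c
  haveI : Algebra.EssFiniteType (MvPolynomial ι k) (UnivQuot c) :=
    Algebra.EssFiniteType.of_finiteType _ _
  -- the ramified locus `E` of the total space over `𝔸ᶥ` and its ideal `J ⊆ D[T]`
  let mkg := Ideal.Quotient.mk (Ideal.span {univComb c})
  set E : Set (PrimeSpectrum (UnivQuot c)) :=
    (Algebra.unramifiedLocus (MvPolynomial ι k) (UnivQuot c))ᶜ with hE
  have hEcl : IsClosed E := Algebra.isOpen_unramifiedLocus.isClosed_compl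
  have hmemE : ∀ x : PrimeSpectrum (UnivQuot c),
      x ∈ E ↔ ¬ Algebra.IsUnramifiedAt (MvPolynomial ι k) x.asIdeal := fun x => Iff.rfl
  set J : Ideal (MvPolynomial ι D) := (vanishingIdeal E).comap mkg with hJ
  have hJE : ∀ x ∈ E, J ≤ x.asIdeal.comap mkg := fun x hx =>
    Ideal.comap_mono ((vanishingIdeal_anti_mono (Set.singleton_subset_iff.mpr hx)).trans
      (vanishingIdeal_singleton x).le)
  have h𝔤J : univComb c ∈ J := by
    rw [hJ, Ideal.mem_comap,
      Ideal.Quotient.eq_zero_iff_mem.mpr (Ideal.subset_span (Set.mem_singleton _))]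
    exact zero_mem _
  -- the fibre hypothesis of generic avoidance over a closed point `𝔪`
  have hfib : ∀ 𝔪 : Ideal D, 𝔪.IsMaximal →
      ∃ s : Finset (Ideal (MvPolynomial ι k)),
        (∀ 𝔟 ∈ s, ringKrullDim (MvPolynomial ι k ⧸ 𝔟) + (1 + 1 : ℕ) ≤ Nat.card ι) ∧
        ∀ 𝔐 : Ideal (MvPolynomial ι D), 𝔐.IsMaximal → J ≤ 𝔐 →
          𝔐.comap (C : D →+* MvPolynomial ι D) = 𝔪 →
            ∃ 𝔟 ∈ s, 𝔟.map (MvPolynomial.map (algebraMap k D)) ≤ 𝔐 := by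
    intro 𝔪 h𝔪
    obtain ⟨hdom, hdvr'⟩ := hdvr 𝔪
    obtain ⟨j, x, hjm, hgen⟩ := hunif 𝔪
    refine ⟨{Literature.RingTheory.KrullDimension.linIdeal (truncAt k c 𝔪)}, ?_, ?_⟩
    · intro 𝔟 h𝔟
      rw [Finset.mem_singleton] at h𝔟
      subst h𝔟
      have hr := two_le_finrank_range_truncAt k c 𝔪 hi₀ hjm hgen
      have := Literature.RingTheory.KrullDimension.ringKrullDim_quotient_linIdeal_add_le
        (truncAt k c 𝔪) (r := 1) hr
      rwa [← Nat.card_eq_fintype_card] at this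
    · intro 𝔐 h𝔐 hJ𝔐 h𝔐𝔪
      haveI : Algebra.FiniteType k (MvPolynomial ι D) :=
        (inferInstance : Algebra.FiniteType k D).trans inferInstance
      -- coordinates `a` of the closed point `𝔐`
      have ha' := fun i =>
        Literature.RingTheory.KrullDimension.exists_sub_algebraMap_mem_of_isMaximal k 𝔐
          (X i : MvPolynomial ι D)
      choose a ha using ha'
      have hX : ∀ i, X i - C (algebraMap k D (a i)) ∈ 𝔐 := fun i => by
        rw [← MvPolynomial.algebraMap_apply]; exact ha i
      have h𝔐eq : 𝔐 = 𝔪.comap (evalParams k a) := by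
        rw [← h𝔐𝔪]; exact eq_comap_eval_comap_C _ hX
      have hg : ∑ i, a i • c i ∈ 𝔪 := by
        rw [← evalParams_univComb k c a, ← Ideal.mem_comap, ← h𝔐eq]
        exact hJ𝔐 h𝔤J
      -- the point `(x, a)` lies in the closed set `E`
      have hxE : pointOver k c a 𝔪 hg ∈ E := by
        have hsub : vanishingIdeal E ≤ (pointOver k c a 𝔪 hg).asIdeal := by
          have h1 : vanishingIdeal E = J.map mkg :=
            (Ideal.map_comap_of_surjective mkg Ideal.Quotient.mk_surjective _).symm
          rw [h1]
          change J.map mkg ≤ (𝔪.comap (evalParams k a)).map mkg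
          exact Ideal.map_mono (h𝔐eq ▸ hJ𝔐)
        have h2 : pointOver k c a 𝔪 hg ∈ zeroLocus (vanishingIdeal E : Set (UnivQuot c)) := by
          rwa [mem_zeroLocus, SetLike.coe_subset_coe]
        rwa [zeroLocus_vanishingIdeal_eq_closure, hEcl.closure_eq] at h2
      refine ⟨Literature.RingTheory.KrullDimension.linIdeal (truncAt k c 𝔪),
        Finset.mem_singleton_self _, ?_⟩
      -- ramified ⇒ `g_a` does not generate `𝔪` locally ⇒ `g_a ∈ 𝔪²` ⇒ `truncAt a = 0`
      have hnu : ¬ Algebra.IsUnramifiedAt (MvPolynomial ι k) (pointOver k c a 𝔪 hg).asIdeal :=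
        (hmemE _).mp hxE
      rw [isUnramifiedAt_pointOver_iff] at hnu
      have hsq := (locallyGenerates_or_mem_sq 𝔪 hg).resolve_left hnu
      have hker := truncAt_eq_zero_of_mem_sq k c 𝔪 hsq
      have hle := Literature.RingTheory.KrullDimension.linIdeal_le_ker_eval (truncAt k c 𝔪) hker
      rw [Ideal.map_le_iff_le_comap]
      intro q hq
      rw [Ideal.mem_comap, h𝔐eq, Ideal.mem_comap, evalParams_map_algebraMap,
        (RingHom.mem_ker.mp (hle hq)), map_zero]
      exact zero_mem _
  -- generic avoidance
  obtain ⟨h, hh0, hh⟩ :=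
    Literature.RingTheory.KrullDimension.exists_ne_zero_forall_mem_of_isMaximal k 1 hD J hfib
  refine ⟨h, hh0, fun a ha 𝔪 h𝔪 hg => ?_⟩
  by_contra hng
  have hxE : pointOver k c a 𝔪 hg ∈ E := by
    rw [hmemE, isUnramifiedAt_pointOver_iff]
    exact hng
  have hJ𝔐 : J ≤ 𝔪.comap (evalParams k a) := by
    rw [← comap_mk_pointOver k c a 𝔪 hg]
    exact hJE _ hxE
  haveI : (𝔪.comap (evalParams k a)).IsMaximal :=
    Ideal.comap_isMaximal_of_surjective _ (evalParams_surjective k a)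
  have h1 := hh _ this hJ𝔐
  rw [Ideal.mem_comap, evalParams_map_algebraMap] at h1
  exact (Ideal.IsMaximal.ne_top inferInstance)
    (Ideal.eq_top_of_isUnit_mem _ h1 ((IsUnit.mk0 _ ha).map _))

include k in
/-- **The same in the genericity vocabulary of `GenericForms.lean`**: for generic `a ∈ kᶥ`
(`IsGeneric`, composable with the other generic conditions of de Jong's 4.13 by
`IsGeneric.and`), `g_a = Σ aᵢ cᵢ` generates the maximal ideal locally at each closed point
containing it — the curve case of Hartshorne II Thm. 8.18 /
`isGeneric_isRegularLocalRing_quotient_linComb` (`BertiniAffine.lean`, see the file header).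
[cite: DeJong1996, Lemma 4.13 (proof), p. 70] -/
theorem isGeneric_forall_locallyGenerates_sum_smul (hD : ringKrullDim D ≤ 1)
    (hdvr : ∀ (𝔪 : Ideal D) [𝔪.IsMaximal],
      ∃ _ : IsDomain (Localization.AtPrime 𝔪), IsDiscreteValuationRing (Localization.AtPrime 𝔪))
    (h1 : ∃ i₀, c i₀ = 1)
    (hunif : ∀ (𝔪 : Ideal D) [𝔪.IsMaximal], ∃ (j : ι) (x : k),
      c j - algebraMap k D x ∈ 𝔪 ∧ LocallyGenerates 𝔪 (c j - algebraMap k D x)) :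
    IsGeneric fun a : ι → k => ∀ 𝔪 : Ideal D, 𝔪.IsMaximal → ∑ i, a i • c i ∈ 𝔪 →
      LocallyGenerates 𝔪 (∑ i, a i • c i) := by
  obtain ⟨h, hh, H⟩ := exists_ne_zero_forall_locallyGenerates k c hD hdvr h1 hunif
  exact ⟨h, hh, fun a ha 𝔪 h𝔪 hg => @H a ha 𝔪 h𝔪 hg⟩

end Main

end Literature.AlgebraicGeometry.Resolution
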